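import Summits.CriticalPhenomena.CardyFormulaZ2.Theorems.CardyMeckeFlipLawToCrossingsUpper
import Literature.Probability.Percolation.QuadCrossingPathCrossings
import Literature.Algebra.EuclideanLattices.LatticePointCounting
import HarnessLib

/-!
# Preliminaries for the lower half of the bridge: connectivity of the open edges drawn through a
# connected set; the square model around the harder quads

Support file for item `LawToCrossings` (stmt-CriticalPhenomena-14828) of route `CardyMeckeFlip`,
sub-problem `CardyFormulaZ2`.

* `exists_pos_forall_lt_dist_of_disjoint` — disjoint compact/closed plane sets are at positive
  distance;
* `reachable_of_mem_edgePairs` — the open lattice edges drawn through a preconnected bounded set `K`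
  inside the open edges form a connected graph (two distinct lattice segments meet only at a common
  end; a disconnection would split `K` into two disjoint closed pieces);
* `exists_adj_step_of_walk` — a walk from a vertex with property `P` to one without makes a step
  from `P` to `¬ P`;
* `image_trans_Ioo`, `apply_mem_carrier_iff`, `apply_mem_closure_iff` — for a square model `Φ` of
  `R` and `H = rotI.trans Φ`, `H` maps the open square onto `Ω` and the closed square onto `Ω̄`.

References: O. Schramm, S. Smirnov, Ann. Probab. 39 (2011), §1.3.
-/

noncomputable section

open Set Filter MeasureTheory Metric Complex
open scoped Topology unitInterval ENNReal
open Literature.Probability.Percolation Literature.Probability.Percolation.QuadCrossing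
open Literature.Probability.RandomPlanarGeometry Literature.Probability.LatticeModels
open Literature.Topology.PlaneTopology

namespace Summit.CriticalPhenomena.CardyFormulaZ2.Theorems.MeckeFlipBridge


/-! ### Disjoint compact sets are at positive distance -/

/-- Two disjoint compact sets of the plane are at positive distance. -/
theorem exists_pos_forall_lt_dist_of_disjoint {A B : Set ℂ} (hA : IsCompact A) (hB : IsClosed B)
    (hAB : Disjoint A B) : ∃ d : ℝ, 0 < d ∧ ∀ a ∈ A, ∀ b ∈ B, d < dist a b := by
  obtain ⟨r, hr, hd⟩ := Metric.exists_pos_forall_lt_edist hA hB hAB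
  refine ⟨r, by exact_mod_cast hr, fun a ha b hb => ?_⟩
  have := hd a ha b hb
  rwa [edist_dist, ← ENNReal.ofReal_coe_nnreal,
    ENNReal.ofReal_lt_ofReal_iff_of_nonneg (NNReal.coe_nonneg r)] at this

/-! ### The graph of open edges drawn through a connected set is connected -/

/-- **The open lattice edges drawn through a preconnected bounded set `K ⊆ O` form a connected
graph.**  If `G` is the graph on `ℤ²` whose edges are the ordered open edge pairs whose drawn
segment meets `K` (`edgePairs δ ω K`), then the first vertices of any two such pairs are joined in
`G`: otherwise the segments of the pairs reachable from the first and those of the others are two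
closed sets covering `K`, both meeting it, hence sharing a point of `K`; two distinct lattice
segments share only a common end, which would propagate reachability. -/
theorem reachable_of_mem_edgePairs {δ : ℝ} (hδ : 0 < δ) {ω : BondConfig (Site 2)} {K : Set ℂ}
    (hK : IsPreconnected K) (hKb : Bornology.IsBounded K) (hKO : K ⊆ openEdgeUnion δ ω)
    (G : SimpleGraph (Site 2)) (hG : ∀ x y, G.Adj x y ↔ (x, y) ∈ edgePairs δ ω K)
    {p q : Site 2 × Site 2} (hp : p ∈ edgePairs δ ω K) (hq : q ∈ edgePairs δ ω K) :
    G.Reachable p.1 q.1 := by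
  classical
  set A : Set (Site 2) := {v | G.Reachable p.1 v} with hA_def
  have hA : ∀ e ∈ edgePairs δ ω K, e.1 ∈ A → e.2 ∈ A := fun e he h1 =>
    h1.trans ((hG _ _).2 he).reachable
  have hA' : ∀ e ∈ edgePairs δ ω K, e.2 ∈ A → e.1 ∈ A := fun e he h2 =>
    h2.trans ((hG _ _).2 he).symm.reachable
  by_contra hcon
  have hq1 : q.1 ∉ A := hcon
  set CA : Set ℂ := ⋃ e ∈ {e ∈ edgePairs δ ω K | e.1 ∈ A},
    segment ℝ (meshPoint δ e.1) (meshPoint δ e.2) with hCA_def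
  set CB : Set ℂ := ⋃ e ∈ {e ∈ edgePairs δ ω K | e.1 ∉ A},
    segment ℝ (meshPoint δ e.1) (meshPoint δ e.2) with hCB_def
  have hfin : (edgePairs δ ω K).Finite := edgePairs_finite hKb hδ
  have hCAc : IsClosed CA := (hfin.subset (sep_subset _ _)).isClosed_biUnion
    fun e _ => (isCompact_segment_complex _ _).isClosed
  have hCBc : IsClosed CB := (hfin.subset (sep_subset _ _)).isClosed_biUnion
    fun e _ => (isCompact_segment_complex _ _).isClosed
  have hcover : K ⊆ CA ∪ CB := fun k hk => by
    obtain ⟨e, he, hke⟩ := exists_mem_edgePairs_of_mem hKO hk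
    by_cases h1 : e.1 ∈ A
    · exact Or.inl (mem_biUnion (show e ∈ {e ∈ edgePairs δ ω K | e.1 ∈ A} from ⟨he, h1⟩) hke)
    · exact Or.inr (mem_biUnion (show e ∈ {e ∈ edgePairs δ ω K | e.1 ∉ A} from ⟨he, h1⟩) hke)
  have hKA : (K ∩ CA).Nonempty := by
    obtain ⟨k, hks, hkK⟩ := hp.2.2
    exact ⟨k, hkK, mem_biUnion (show p ∈ {e ∈ edgePairs δ ω K | e.1 ∈ A} from
      ⟨hp, (SimpleGraph.Reachable.refl _ : G.Reachable p.1 p.1)⟩) hks⟩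
  have hKB : (K ∩ CB).Nonempty := by
    obtain ⟨k, hks, hkK⟩ := hq.2.2
    exact ⟨k, hkK, mem_biUnion (show q ∈ {e ∈ edgePairs δ ω K | e.1 ∉ A} from ⟨hq, hq1⟩) hks⟩
  obtain ⟨z, -, hzA, hzB⟩ := isPreconnected_closed_iff.1 hK CA CB hCAc hCBc hcover hKA hKB
  rw [hCA_def, mem_iUnion₂] at hzA
  rw [hCB_def, mem_iUnion₂] at hzB
  obtain ⟨e, ⟨he, heA⟩, hze⟩ := hzA
  obtain ⟨e', ⟨he', he'A⟩, hze'⟩ := hzB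
  by_cases hee : s(e.1, e.2) = s(e'.1, e'.2)
  · rcases Sym2.eq_iff.1 hee with ⟨h1, -⟩ | ⟨h1, h2⟩
    · exact he'A (h1 ▸ heA)
    · have : e.2 ∈ A := hA e he heA
      exact he'A (h2 ▸ this)
  · obtain ⟨v, -, hv, hv'⟩ :=
      exists_eq_meshPoint_of_mem_segment_inter hδ.ne' he.1 he'.1 hee hze hze'
    have hvA : v ∈ A := by
      rcases Sym2.mem_iff.1 hv with rfl | rfl
      · exact heA
      · exact hA e he heA
    rcases Sym2.mem_iff.1 hv' with h1 | h2
    · exact he'A (h1 ▸ hvA)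
    · exact he'A (hA' e' he' (h2 ▸ hvA))

/-- In a walk from a vertex satisfying `P` to one violating it, some step leads from a vertex
satisfying `P` to an adjacent vertex violating it. -/
theorem exists_adj_step_of_walk {V : Type*} {G : SimpleGraph V} (P : V → Prop) {u v : V}
    (w : G.Walk u v) (hu : P u) (hv : ¬ P v) : ∃ a b : V, G.Adj a b ∧ P a ∧ ¬ P b := by
  obtain ⟨d, -, h1, h2⟩ := w.exists_boundary_dart {x | P x} hu hv
  exact ⟨d.fst, d.snd, d.adj, h1, h2⟩

/-! ### Geometry of the square model around the harder quads -/

section SquareModel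

variable {R : ConformalRectangle} {Φ : ℂ ≃ₜ ℂ} (h : IsSquareModel R Φ)
include h

/-- `H = rotI.trans Φ` maps the open square onto the domain `Ω = R.carrier`. -/
theorem image_trans_Ioo :
    ((Homeomorph.mulLeft₀ Complex.I Complex.I_ne_zero).trans Φ) '' (Ioo (-1 : ℝ) 1 ×ℂ Ioo (-1 : ℝ) 1) =
      R.carrier := by
  rw [← h.image_carrier, unitSquareQuad_carrier]
  change (⇑Φ ∘ ⇑(Homeomorph.mulLeft₀ Complex.I Complex.I_ne_zero)) '' _ = _
  rw [image_comp]
  congr 1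
  ext w
  simp only [mem_image, mem_reProdIm, mem_Ioo, rotI_apply]
  constructor
  · rintro ⟨z, ⟨⟨h1, h2⟩, h3, h4⟩, rfl⟩
    have hre : (Complex.I * z).re = -z.im := by simp
    have him : (Complex.I * z).im = z.re := by simp
    rw [hre, him]
    exact ⟨⟨by linarith, by linarith⟩, h1, h2⟩
  · rintro ⟨⟨h1, h2⟩, h3, h4⟩
    refine ⟨-Complex.I * w, ?_, by rw [← mul_assoc, mul_neg, Complex.I_mul_I, neg_neg, one_mul]⟩
    have hre : (-Complex.I * w).re = w.im := by simp
    have him : (-Complex.I * w).im = -w.re := by simp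
    rw [hre, him]
    exact ⟨⟨h3, h4⟩, by linarith, by linarith⟩

/-- A point `H w` lies in `Ω` iff `w` lies in the open square. -/
theorem apply_mem_carrier_iff (w : ℂ) :
    ((Homeomorph.mulLeft₀ Complex.I Complex.I_ne_zero).trans Φ) w ∈ R.carrier ↔
      w ∈ Ioo (-1 : ℝ) 1 ×ℂ Ioo (-1 : ℝ) 1 := by
  rw [← image_trans_Ioo h]
  exact ((Homeomorph.mulLeft₀ Complex.I Complex.I_ne_zero).trans Φ).injective.mem_set_image

/-- A point `H w` lies in `Ω̄` iff `w` lies in the closed square. -/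
theorem apply_mem_closure_iff (w : ℂ) :
    ((Homeomorph.mulLeft₀ Complex.I Complex.I_ne_zero).trans Φ) w ∈ closure R.carrier ↔
      w ∈ Icc (-1 : ℝ) 1 ×ℂ Icc (-1 : ℝ) 1 := by
  have hc := carrier_rq ((Homeomorph.mulLeft₀ Complex.I Complex.I_ne_zero).trans Φ) one_pos one_pos
  rw [carrier_quadOf h] at hc
  rw [hc]
  exact ((Homeomorph.mulLeft₀ Complex.I Complex.I_ne_zero).trans Φ).injective.mem_set_image


end SquareModel

end Summit.CriticalPhenomena.CardyFormulaZ2.Theorems.MeckeFlipBridge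

end
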